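import Literature.AnabelianGeometry.SemiGraphs.PSCCoveringDatumRamificationProofs
import Literature.AnabelianGeometry.SemiGraphs.PSCCoveringBranchData
import Literature.AnabelianGeometry.SemiGraphs.PSCRamificationProofs
import HarnessLib

/-!
# [CombGC] Rmk. 1.4.2 for the covering data `G_U`, UNCONDITIONALLY: the level-`U` count statement is a theorem

PROOF-ONLY companion (abc-iut cell, sub-DAG row CombGC:Thm1.6(iii)/T16-L16, GAP-LEDGER G-w5d174-2;
second-reader bridge by abc-iut-w4-d016).  Mochizuki, *A combinatorial version of the Grothendieck
conjecture*, Tohoku Math. J. **59** (2007) [CombGC], Def. 1.1 (ii) (author's ms pp. 6–7: the finite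
étale `Π_G`-covering attached to an open subgroup of `Π_G`) and Rmk. 1.4.2 (p. 11: "if `G' → G` is
a finite étale `Π^unr_G`-covering …, then one verifies immediately that `G' → G` is verticially
purely totally ramified if and only if the equality `i(G') = deg(G'/G)·(i(G) − 1) + 1` is satisfied"),
as kept by [IUTchI] Rmk. 1.2.3 (iii) (kurims p. 41).

STATE OF THE ROW BEFORE THIS FILE.  abc-iut-w5-d174's `verticialPureRamificationCount_levels_of_restrict`
(`PSCCoveringDatumRamificationProofs`) derives the level-`U` form of Rmk. 1.4.2 — the binder `hRC` of
`PSCUnrVerticialNecessityProofs` / `hRCG` of [IUTchI] Rmk. 1.2.3 (vii) — from the typed predicate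
`VerticialPureRamificationCount` APPLIED TO THE COVERING DATA `G.restrict U hU` at every level `U`;
consumers (abc-iut-L5-t6's `Rmk123.unrVerticialNecessityReduction_of_origin`) supply that input from the
ORIGIN-LEVEL statements `CyclicCuspidallyTotallyRamifiedIffHolds Ω` / `RamificationCountsHold Ω`
together with the repaired covering statement `RestrictBDOfPSCTypeHolds Ω` (abc-iut-L3-t4, after
finding F-L5t6g4-1).  OBSERVATION recorded here: that detour is unnecessary — abc-iut-L3's
`PSCRamificationProofs` PROVES `PSCDatum.verticialPureRamificationCount : G.VerticialPureRamificationCount`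
for EVERY datum `G` (the three numerical claims of Rmk. 1.4.2 are pure group theory over the
interface), in particular for every covering datum `G.restrict U hU`.  Hence:

* `verticialPureRamificationCount_restrict` — Rmk. 1.4.2 (second claim) for the covering datum `G_U`,
  for every datum `G` and every open `U` of finite index, with no origin hypothesis;
* **`verticialPureRamificationCount_levels`** — the binder `hRC`/`hRCG` (GAP-LEDGER G-w5d174-2) as an
  unconditional THEOREM for every datum on a profinite (compact) `Π_G`: no `Ω`, no branch data, no
  `RestrictBDOfPSCTypeHolds`;
* `cuspidalPureRamificationCount_restrictBD_iff`, `verticialPureRamificationCount_restrictBD_iff`,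
  `verticialMinusNodalCount_restrictBD_iff` — for the record, the three claims for the repaired datum
  `G.restrictBD U hU bd` (`PSCCoveringBranchData`) and for `restrict` are the same proposition
  (`Iff.rfl`: they are class (i) — vertices, nodes, cusps, representative subgroups, `Σ`,
  `Ker(Π ↠ Π^unr)` — and do not see the node abutments that F-L5t6g4-1 is about), and
  `verticialPureRamificationCount_restrictBD` — the claim for `restrictBD bd`, unconditionally.

Consequence for consumers (BY NAME, no file of theirs is touched): in
`Rmk123.unrVerticialNecessityReduction_of_origin` the hypotheses `hcount` and `hres` can be dropped;
in `PSCUnrVerticialNecessityProofs` the binders `hRCG`/`hRCH` are instances of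
`verticialPureRamificationCount_levels`.  0 defs; nothing here takes a side on [IUTchIII] Cor. 3.12.
[cite: MochizukiCombGC2007, Rmk 1.4.2 p.11] [cite: MochizukiCombGC2007, Def 1.1(ii) pp.6-7]
[cite: Mochizuki2012, IUTchI Rmk 1.2.3(iii) p.41]
-/

namespace Literature.AnabelianGeometry.SemiGraphs

namespace PSCDatum

universe u

variable {P : Type u} [Group P] [TopologicalSpace P] [IsTopologicalGroup P] (G : PSCDatum P)
  (U : Subgroup P) [U.FiniteIndex] (hU : IsOpen (U : Set P))

/-! ### Rmk. 1.4.2 for the covering datum, unconditionally -/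

/-- **[CombGC] Rmk. 1.4.2 (second claim) for the covering datum `G_U`**, for EVERY datum `G` and every
open subgroup `U ⊆ Π_G` of finite index: an instance of abc-iut-L3's `verticialPureRamificationCount`
(proved for every `PSCDatum`). [cite: MochizukiCombGC2007, Rmk 1.4.2 p.11] -/
theorem verticialPureRamificationCount_restrict :
    (G.restrict U hU).VerticialPureRamificationCount :=
  (G.restrict U hU).verticialPureRamificationCount

variable {G} in
/-- **The level-`U` form of [CombGC] Rmk. 1.4.2 / [IUTchI] Rmk. 1.2.3 (iii) — the binder `hRC` of
`PSCUnrVerticialNecessityProofs` (GAP-LEDGER G-w5d174-2) — as an unconditional THEOREM**: for every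
datum `G` on a profinite (compact) `Π_G`, every prime `l` with `Σ_G = {l}`, every open normal level
`U ⊇ Ker(Π_G ↠ Π^unr_G)` and every open `H' ⊆ U`, normal in `U`, of index `l ^ k` (`0 < k`) containing
that kernel: `n(G_{H'}) = [U : H']·n(G_U)`, and `G_{H'} → G_U` is verticially purely totally ramified
iff `i(G_{H'}) = [U : H']·(i(G_U) − 1) + 1`.  Route: abc-iut-w5-d174's
`verticialPureRamificationCount_levels_of_restrict` fed with `verticialPureRamificationCount_restrict`.
[cite: MochizukiCombGC2007, Rmk 1.4.2 p.11] -/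
theorem verticialPureRamificationCount_levels [CompactSpace P] :
    ∀ (l k : ℕ) (U H' : Subgroup P), G.Sigma = {l} → 0 < k → U.Normal → IsOpen (U : Set P) →
      G.unrKer ≤ U → H' ≤ U → (H'.subgroupOf U).Normal → IsOpen (H' : Set P) →
      H'.relIndex U = l ^ k → G.unrKer ≤ H' →
      (G.nodeCount H' = G.nodeCount U * H'.relIndex U ∧
        (G.IsVerticiallyPurelyTotallyRamified U H' ↔
          (G.vertCount H' : ℤ) = (H'.relIndex U : ℤ) * ((G.vertCount U : ℤ) - 1) + 1)) :=
  verticialPureRamificationCount_levels_of_restrict (G := G) fun U _ hU _ =>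
    G.verticialPureRamificationCount_restrict U hU

/-! ### For the record: the three claims do not see the branch data -/

variable (bd : G.BranchData)

/-- [CombGC] Rmk. 1.4.2, first claim (cusp count of cuspidally purely totally ramified coverings), for
the covering datum built from ANY branch data, is literally the claim for `restrict` (class (i): cusps,
`Σ`, indices). [cite: MochizukiCombGC2007, Rmk 1.4.2 p.11] -/
theorem cuspidalPureRamificationCount_restrictBD_iff :
    (G.restrictBD U hU bd).CuspidalPureRamificationCount ↔
      (G.restrict U hU).CuspidalPureRamificationCount := Iff.rfl

/-- [CombGC] Rmk. 1.4.2, second claim, for `restrictBD bd` is literally the claim for `restrict`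
(class (i): vertices, nodes, `Ker(Π ↠ Π^unr)`, indices). [cite: MochizukiCombGC2007, Rmk 1.4.2 p.11] -/
theorem verticialPureRamificationCount_restrictBD_iff :
    (G.restrictBD U hU bd).VerticialPureRamificationCount ↔
      (G.restrict U hU).VerticialPureRamificationCount := Iff.rfl

/-- [CombGC] Rmk. 1.4.2, third claim (the equivalent `i − n` form), same transfer.
[cite: MochizukiCombGC2007, Rmk 1.4.2 p.11] -/
theorem verticialMinusNodalCount_restrictBD_iff :
    (G.restrictBD U hU bd).VerticialMinusNodalCount ↔
      (G.restrict U hU).VerticialMinusNodalCount := Iff.rfl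

/-- [CombGC] Rmk. 1.4.2 (second claim) for the REPAIRED covering datum `G.restrictBD U hU bd`,
unconditionally. [cite: MochizukiCombGC2007, Rmk 1.4.2 p.11] -/
theorem verticialPureRamificationCount_restrictBD :
    (G.restrictBD U hU bd).VerticialPureRamificationCount :=
  (G.restrictBD U hU bd).verticialPureRamificationCount

end PSCDatum

end Literature.AnabelianGeometry.SemiGraphs
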